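import Summits.BirchSwinnertonDyer.BirchSwinnertonDyer.Theorems.SignedLowerHalvesSprungLowerDivisibilityAtThreeKatoSporadicLedger
import Summits.BirchSwinnertonDyer.BirchSwinnertonDyer.Theorems.SignedLowerHalvesSprungLowerDivisibilityAtThreeOfKatoMainIdentity
import Summits.BirchSwinnertonDyer.Rank1Residual.X1.LambdaSqueezeAlgebra
import Literature.NumberTheory.EllipticCurves.IwasawaAlgebraHeightOneCriterionProofs
import Literature.NumberTheory.EllipticCurves.Sprung2012.SharpFlatSelmerDualExistsProofs
import Literature.NumberTheory.EllipticCurves.Sprung2017.SharpFlatNonvanishingProofs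
import Literature.NumberTheory.EllipticCurves.SupersingularIrreducibleProofs
import HarnessLib

/-!
# Crux K1 `SprungLowerDivisibilityAtThree` (stmt-BirchSwinnertonDyer-19875), line `chromatic-common-zeros` (skeleton v8),
# stub K_spor `stub_katoFineLowerSporadic`: SOCKET β — the λ-BUDGET door (STUB-PLAN §3 rank 2: β1 `LambdaSqueeze` + β3 door)
# (`--supports` 19875 as helper; closes nothing; K_spor / K1 / leaf X8 / BSD are NOT proved here)

Cell `bsd-ssimc`, width seat `cruxlead-…-19875-w2` (g7); fourth file of the sporadic ledger (`…KatoSporadicLedger`, `…LedgerX8`,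
`…LedgerKato`). STUB-PLAN-stub_katoFineLowerSporadic §3 rank 2 («PLAN β λ-BUDGET socket; k5's colour-free fine form is the one to land»):

* §1 β1 `LambdaSqueeze` (pure `Λ`-algebra, `Λ = ℤ_p⟦T⟧`): for finitely generated torsion `Λ`-modules `M`, `N` with
  `ℓ_𝔮 M ≤ ℓ_𝔮 N` at every height-one `𝔮 ∌ p`: `λ(M) ≤ λ(N)` (`lambdaInvariant_le_of_lengthAt_le`), and if moreover `λ(N) ≤ λ(M)`
  then `ℓ_𝔮 M = ℓ_𝔮 N` at every height-one `𝔮 ∌ p` (`lengthAt_eq_of_lengthAt_le_of_lambdaInvariant_le`). Route: `char M = (g)`,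
  `char N = (g')`, the height-one criterion gives `p^k g' = g·h`, `λ` is additive (`X1.MuLambda.lam_mul`) and `λ(gen) = λ(module)`
  (`X1.ParitySqueeze.lam_generator_eq_lambdaInvariant`), so `λ(N) = λ(M) + λ(h)`; `λ(h) = 0` makes `h = p^μ·unit` invisible off `(p)`.
* §2 β3 THE λ-BUDGET DOOR on a ♯/♭ package `C` of colour `•` (`L^• ≠ 0`, `E[p]` irreducible, Néron-normalised `G₁ ≠ 0`, a f.g.
  torsion dual datum `D` of `Sel^•` carrying Thm. 7.16's output `hKato`): Kato's direction `x ≤ k` off `(p)` is the tree theorem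
  `fine_le_zeta_of_pow_mul_mem_charIdeal` (p648387), so ALWAYS `λ(Y.X) ≤ λ(I.H ⧸ C.Z)` (`…fine_lambdaInvariant_le_zeta_lambdaInvariant`),
  and the ONE integer inequality `λ(I.H ⧸ C.Z) ≤ λ(Y.X)` («FineLambdaBudget», DISPLAYED hypothesis) forces
  `ℓ_𝔭(I.H ⧸ C.Z) = ℓ_𝔭 Y.X` — in particular Kato's fine inequality — at EVERY height-one `𝔭 ∌ p`: sporadic AND cyclotomic
  (`…katoFineLower_offP_of_lambdaInvariant_le`). So for one pair «K_spor ∧ S4b-cyc ∧ S4b-T off (3)» ⟸ ONE integer.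
* §3 the X8-pair form in the binder shape `h714 → h716 → h3 → …`: `ClassX8.katoFineLower_offThree_of_lambdaBudget`.

HONEST FRAMING (STUB-PLAN β4): the budget `λ(𝐇¹/Z) ≤ λ(X₀)` is NOT weaker than the three Eisenstein stubs jointly — its merit is
SHAPE (one integer: zeros counted, not located; μ-free off `(3)`; composable with transport and finite-layer weighing); no class-wide
engine supplies it at `(3, a₃ = ±3)` today. CONDITIONAL inputs are displayed (`hKato` = output of `thm716_sharpFlatCharIdeal_divisibility`;
in §3 the named facts `h714`, `h716`, `h3`). KEYING (§0bis): `Y` γ-keyed as in the skeleton; `λ` is ι-invariant anyway.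

References: [Kato2004Asterisque] Conj. 12.10 (p. 224), Thm. 12.5 (p. 222), §17.13 (p. 280); [Sprung2012] Thm. 7.14, Thm. 7.16 (p. 1504),
Prop. 7.19 (p. 1505); [GreenbergVatsal2000] (1)–(2) and p. 4; [Washington1997] §7.1, §13.2; tree: `X1/MuLambdaAlgebra`, `X1/LambdaSqueezeAlgebra`,
`IwasawaAlgebraHeightOneCriterionProofs`, `…OfKatoMainIdentity` (package bookkeeping), `…KatoSporadicLedger`.
-/

set_option linter.dupNamespace false
set_option autoImplicit false

noncomputable section

open scoped Classical NumberField MatrixGroups ModularForm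

open NumberField IsDedekindDomain CongruenceSubgroup WeierstrassCurve Field
  Literature.NumberTheory.EllipticCurves Literature.NumberTheory.EllipticCurves.ModularForms
  Literature.NumberTheory.EllipticCurves.ZpExtension Literature.NumberTheory.EllipticCurves.Sprung2017
  Literature.NumberTheory.EllipticCurves.Sprung2012 Literature.NumberTheory.EllipticCurves.Rank1Residual
  Literature.NumberTheory.EllipticCurves.IwasawaAlgebra Literature.NumberTheory.EllipticCurves.Kato2004
  Literature.NumberTheory.EllipticCurves.Module
  Summit.BirchSwinnertonDyer.BirchSwinnertonDyer.Theorems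
  Summit.BirchSwinnertonDyer.BirchSwinnertonDyer.Theorems.SmallImageSignedMuDefect
  Summit.BirchSwinnertonDyer.Rank1Residual.X1

namespace Summit.BirchSwinnertonDyer.BirchSwinnertonDyer.Theorems.ChromaticCommonZeros

/-! ### §1 β1 `LambdaSqueeze` — pure `Λ`-algebra -/

section Squeeze

variable {p : ℕ} [Fact p.Prime]

/-- An element of `Λ` with `λ = 0` is `p^μ · unit`, hence lies in no prime `𝔮 ∌ p`. [cite: Washington1997, §7.1] -/
theorem not_mem_of_lam_eq_zero {h : IwasawaAlgebra p} (hh : h ≠ 0) (hlam : MuLambda.lam h = 0)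
    (𝔮 : PrimeSpectrum (IwasawaAlgebra p)) (hp𝔮 : (p : IwasawaAlgebra p) ∉ 𝔮.asIdeal) : h ∉ 𝔮.asIdeal := by
  -- `h = C(p^μ) · pfree h`, `pfree h` a unit
  have hfac := MuLambda.eq_C_pow_mu_mul_pfree h
  have hred := MuLambda.red_pfree_ne_zero hh
  have h0 : MuLambda.mu (MuLambda.pfree h) = 0 ∧ MuLambda.pfree (MuLambda.pfree h) = MuLambda.pfree h :=
    MuLambda.mu_eq_and_pfree_eq hred (by rw [pow_zero, map_one, one_mul])
  have hlam' : MuLambda.lam (MuLambda.pfree h) = 0 := by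
    unfold MuLambda.lam at hlam ⊢
    rw [h0.2]; exact hlam
  have hunit : IsUnit (MuLambda.pfree h) :=
    (MuLambda.isUnit_iff_mu_eq_zero_and_lam_eq_zero _).mpr ⟨MuLambda.pfree_ne_zero hh, h0.1, hlam'⟩
  intro hmem
  rw [hfac] at hmem
  rcases 𝔮.isPrime.mem_or_mem hmem with hC | hu
  · exact C_not_mem_of_natCast_p_not_mem (pow_ne_zero _ (by exact_mod_cast (Fact.out : p.Prime).ne_zero)) 𝔮 hp𝔮 hC
  · exact 𝔮.isPrime.ne_top (Ideal.eq_top_of_isUnit_mem _ hu hunit)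

variable {M N : Type*} [AddCommGroup M] [Module (IwasawaAlgebra p) M] [AddCommGroup N] [Module (IwasawaAlgebra p) N]

/-- `ℓ_𝔮 X = ℓ_𝔮 Λ/(x)` at a height-one `𝔮` when `char X = (x)`, `x ≠ 0`, `X` finitely generated torsion (the characteristic ideal
determines the height-one lengths). [cite: SkinnerUrban2014, §3.1.6 (p. 20)] [cite: Washington1997, §13.2] -/
theorem lengthAt_eq_lengthAt_quotient_span_of_charIdeal_eq [Module.Finite (IwasawaAlgebra p) M]
    (hM : Module.IsTorsion (IwasawaAlgebra p) M) {x : IwasawaAlgebra p} (hx : x ≠ 0)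
    (hcx : Module.charIdeal (IwasawaAlgebra p) M = Ideal.span {x})
    (𝔮 : PrimeSpectrum (IwasawaAlgebra p)) (h𝔮 : 𝔮.asIdeal.height = 1) :
    lengthAt (IwasawaAlgebra p) M 𝔮 = lengthAt (IwasawaAlgebra p) (IwasawaAlgebra p ⧸ Ideal.span {x}) 𝔮 := by
  have hbyx := isTorsionBy_quotient_span_singleton (R := IwasawaAlgebra p) x
  refine SkinnerUrban2014.lengthAt_eq_of_charIdeal_eq hM
    (fun y ↦ ⟨⟨x, mem_nonZeroDivisors_of_ne_zero hx⟩, @hbyx y⟩) ?_ 𝔮 h𝔮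
  rw [hcx, Module.charIdeal_eq_span_of_lengthAt_eq_quotient hx fun _ _ ↦ rfl]

/-- **Generators and a cofactor.** For finitely generated torsion `Λ`-modules `M`, `N` with `ℓ_𝔮 M ≤ ℓ_𝔮 N` at every height-one
`𝔮 ∌ p`: generators `g` of `char M`, `g'` of `char N` (both `≠ 0`), some `k` and `h ≠ 0` with `C(p)^k · g' = g · h`, and
`λ(N) = λ(M) + λ(h)`. (Height-one criterion + additivity of `λ`.) [cite: Washington1997, §13.2] [cite: GreenbergVatsal2000, (1)–(2)] -/
theorem exists_generators_cofactor_of_lengthAt_le [Module.Finite (IwasawaAlgebra p) M] [Module.Finite (IwasawaAlgebra p) N]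
    (hM : Module.IsTorsion (IwasawaAlgebra p) M) (hN : Module.IsTorsion (IwasawaAlgebra p) N)
    (h : ∀ 𝔮 : PrimeSpectrum (IwasawaAlgebra p), 𝔮.asIdeal.height = 1 → (p : IwasawaAlgebra p) ∉ 𝔮.asIdeal →
      lengthAt (IwasawaAlgebra p) M 𝔮 ≤ lengthAt (IwasawaAlgebra p) N 𝔮) :
    ∃ (g g' hh : IwasawaAlgebra p) (k : ℕ), g ≠ 0 ∧ g' ≠ 0 ∧ hh ≠ 0 ∧
      Module.charIdeal (IwasawaAlgebra p) M = Ideal.span {g} ∧ Module.charIdeal (IwasawaAlgebra p) N = Ideal.span {g'} ∧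
      PowerSeries.C (p : ℤ_[p]) ^ k * g' = g * hh ∧
      lambdaInvariant p N = lambdaInvariant p M + MuLambda.lam hh := by
  obtain ⟨g, hg⟩ := (charIdeal_isPrincipal_holds p M : (Module.charIdeal (IwasawaAlgebra p) M).IsPrincipal)
  obtain ⟨g', hg'⟩ := (charIdeal_isPrincipal_holds p N : (Module.charIdeal (IwasawaAlgebra p) N).IsPrincipal)
  have hgM : Module.charIdeal (IwasawaAlgebra p) M = Ideal.span {g} := hg
  have hgN : Module.charIdeal (IwasawaAlgebra p) N = Ideal.span {g'} := hg'
  have hg0 : g ≠ 0 := fun h0 =>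
    Module.charIdeal_ne_bot (IwasawaAlgebra p) M (by rw [hgM, h0, Ideal.span_singleton_eq_bot])
  have hg'0 : g' ≠ 0 := fun h0 =>
    Module.charIdeal_ne_bot (IwasawaAlgebra p) N (by rw [hgN, h0, Ideal.span_singleton_eq_bot])
  -- `ℓ_𝔮 M = ℓ_𝔮 Λ/(g)`
  have hMg : ∀ 𝔮 : PrimeSpectrum (IwasawaAlgebra p), 𝔮.asIdeal.height = 1 →
      lengthAt (IwasawaAlgebra p) (IwasawaAlgebra p ⧸ Ideal.span {g}) 𝔮 = lengthAt (IwasawaAlgebra p) M 𝔮 :=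
    fun 𝔮 h𝔮 => (lengthAt_eq_lengthAt_quotient_span_of_charIdeal_eq hM hg0 hgM 𝔮 h𝔮).symm
  -- the height-one criterion: `C(p)^k · g' ∈ (g)`
  obtain ⟨k, hk⟩ := Module.exists_pow_mul_mem_span_of_mem_charIdeal_of_lengthAt_le hN
    (IwasawaAlgebra.prime_C p) hg0 (fun 𝔮 h𝔮 hp𝔮 => by
      rw [hMg 𝔮 h𝔮]
      exact h 𝔮 h𝔮 (by rwa [map_natCast] at hp𝔮))
  have hk' := hk g' (by rw [hgN]; exact Ideal.mem_span_singleton_self g')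
  obtain ⟨hh, hhh⟩ := Ideal.mem_span_singleton'.mp hk'
  -- hhh : hh * g = C p ^ k * g'
  have hpk0 : PowerSeries.C (p : ℤ_[p]) ^ k * g' ≠ 0 :=
    mul_ne_zero (pow_ne_zero _ (IwasawaAlgebra.prime_C p).ne_zero) hg'0
  have hh0 : hh ≠ 0 := by rintro rfl; rw [zero_mul] at hhh; exact hpk0 hhh.symm
  refine ⟨g, g', hh, k, hg0, hg'0, hh0, hgM, hgN, by rw [← hhh, mul_comm], ?_⟩
  -- λ bookkeeping
  have e1 : MuLambda.lam (PowerSeries.C (p : ℤ_[p]) ^ k * g') = MuLambda.lam g' := by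
    rw [← MuLambda.C_pow_eq]; exact ParitySqueeze.lam_C_pow_mul k hg'0
  have e2 : MuLambda.lam (g * hh) = MuLambda.lam g + MuLambda.lam hh := MuLambda.lam_mul hg0 hh0
  rw [← ParitySqueeze.lam_generator_eq_lambdaInvariant M hM hg0 hgM,
    ← ParitySqueeze.lam_generator_eq_lambdaInvariant N hN hg'0 hgN, ← e1, ← hhh, mul_comm hh g, e2]

/-- **Kato's direction costs no `λ`: `ℓ_𝔮 M ≤ ℓ_𝔮 N` off `(p)` ⟹ `λ(M) ≤ λ(N)`** (finitely generated torsion `Λ`-modules).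
[cite: GreenbergVatsal2000, (1)–(2)] [cite: Washington1997, §13.2] -/
theorem lambdaInvariant_le_of_lengthAt_le [Module.Finite (IwasawaAlgebra p) M] [Module.Finite (IwasawaAlgebra p) N]
    (hM : Module.IsTorsion (IwasawaAlgebra p) M) (hN : Module.IsTorsion (IwasawaAlgebra p) N)
    (h : ∀ 𝔮 : PrimeSpectrum (IwasawaAlgebra p), 𝔮.asIdeal.height = 1 → (p : IwasawaAlgebra p) ∉ 𝔮.asIdeal →
      lengthAt (IwasawaAlgebra p) M 𝔮 ≤ lengthAt (IwasawaAlgebra p) N 𝔮) :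
    lambdaInvariant p M ≤ lambdaInvariant p N := by
  obtain ⟨g, g', hh, k, -, -, -, -, -, -, hlam⟩ := exists_generators_cofactor_of_lengthAt_le hM hN h
  rw [hlam]; exact Nat.le_add_right _ _

/-- **β1 `LambdaSqueeze`.** Finitely generated torsion `Λ`-modules `M`, `N` with `ℓ_𝔮 M ≤ ℓ_𝔮 N` at every height-one `𝔮 ∌ p` and
the REVERSE global inequality `λ(N) ≤ λ(M)` have `ℓ_𝔮 M = ℓ_𝔮 N` at every height-one `𝔮 ∌ p`: the cofactor `h` in `p^k g' = g·h`
has `λ(h) = 0`, so it is `p^μ · unit`, invisible off `(p)`. (Greenberg–Vatsal: «the equality `λ_alg = λ_an` implies that `f_alg` and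
`f_an` differ by multiplication by a power of `p`».) [cite: GreenbergVatsal2000, p. 4] [cite: Washington1997, §7.1, §13.2] -/
theorem lengthAt_eq_of_lengthAt_le_of_lambdaInvariant_le [Module.Finite (IwasawaAlgebra p) M]
    [Module.Finite (IwasawaAlgebra p) N]
    (hM : Module.IsTorsion (IwasawaAlgebra p) M) (hN : Module.IsTorsion (IwasawaAlgebra p) N)
    (h : ∀ 𝔮 : PrimeSpectrum (IwasawaAlgebra p), 𝔮.asIdeal.height = 1 → (p : IwasawaAlgebra p) ∉ 𝔮.asIdeal →
      lengthAt (IwasawaAlgebra p) M 𝔮 ≤ lengthAt (IwasawaAlgebra p) N 𝔮)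
    (hlam : lambdaInvariant p N ≤ lambdaInvariant p M)
    (𝔮 : PrimeSpectrum (IwasawaAlgebra p)) (h𝔮 : 𝔮.asIdeal.height = 1) (hp𝔮 : (p : IwasawaAlgebra p) ∉ 𝔮.asIdeal) :
    lengthAt (IwasawaAlgebra p) M 𝔮 = lengthAt (IwasawaAlgebra p) N 𝔮 := by
  obtain ⟨g, g', hh, k, hg0, hg'0, hh0, hgM, hgN, hrel, hlam'⟩ := exists_generators_cofactor_of_lengthAt_le hM hN h
  have hlh : MuLambda.lam hh = 0 := by omega
  -- `ℓ_𝔮 M = ℓ_𝔮 Λ/(g)`, `ℓ_𝔮 N = ℓ_𝔮 Λ/(g')`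
  rw [lengthAt_eq_lengthAt_quotient_span_of_charIdeal_eq hM hg0 hgM 𝔮 h𝔮,
    lengthAt_eq_lengthAt_quotient_span_of_charIdeal_eq hN hg'0 hgN 𝔮 h𝔮]
  -- `ℓ_𝔮 Λ/(g') = ℓ_𝔮 Λ/(C(p)^k g') = ℓ_𝔮 Λ/(g·h) = ℓ_𝔮 Λ/(g) + 0`
  have hpk : (PowerSeries.C (p : ℤ_[p]) : IwasawaAlgebra p) ^ k = PowerSeries.C ((p : ℤ_[p]) ^ k) := (map_pow _ _ _).symm
  have e1 : lengthAt (IwasawaAlgebra p) (IwasawaAlgebra p ⧸ Ideal.span {g'}) 𝔮 =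
      lengthAt (IwasawaAlgebra p) (IwasawaAlgebra p ⧸ Ideal.span {PowerSeries.C (p : ℤ_[p]) ^ k * g'}) 𝔮 := by
    rw [hpk, lengthAt_quotient_span_C_mul_eq_of_natCast_p_not_mem
      (pow_ne_zero _ (by exact_mod_cast (Fact.out : p.Prime).ne_zero)) g' 𝔮 hp𝔮]
  rw [e1, hrel, lengthAt_quotient_span_singleton_mul hh hg0 𝔮,
    (lengthAt_quotient_span_eq_zero_iff_not_mem hh 𝔮).mpr (not_mem_of_lam_eq_zero hh0 hlh 𝔮 hp𝔮), add_zero]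

end Squeeze

/-! ### §2 β3 The λ-budget door on a ♯/♭ package -/

section Package

variable (W : WeierstrassCurve ℚ) [W.IsElliptic] (p : ℕ) [Fact p.Prime]
  [ContinuousSMul ℤ_[p] (W.tateModule p)] [Module.Free ℤ_[p] (W.tateModule p)]
  [Module.Finite ℤ_[p] (W.tateModule p)]
  {N : ℕ} {f : CuspForm (Gamma0 N) 2} {ϖ : ℚ} {κ : ZpExtension ℚ p} {γ : absoluteGaloisGroup ℚ}
  {E : Type} [Field E] [Algebra ℚ E] {ι : AlgebraicClosure ℚ →ₐ[ℚ] AlgebraicClosure E} {ap : ℤ}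
  {g : absoluteGaloisGroup E} {c : ℕ → localPoints W E} {I : IwasawaH1Data W p κ γ}

/-- **Kato's direction costs no `λ` on the package: `λ(X₀) ≤ λ(𝐇¹/Z)`.** Package `C` of colour `•` (`L^• ≠ 0`, `E[p]` irreducible,
Néron-normalised `G₁ ≠ 0`), a finitely generated torsion dual datum `D` of `Sel^•` with Thm. 7.16's output `hKato`, any fine dual `Y`:
`lambdaInvariant p Y.X ≤ lambdaInvariant p (I.H ⧸ C.Z)` (termwise `x ≤ k` off `(p)`, `fine_le_zeta_of_pow_mul_mem_charIdeal`).
[cite: Sprung2012, Thm. 7.16 (p. 1504), Prop. 7.19 (p. 1505)] [cite: Kato2004Asterisque, Thm. 12.5 (p. 222)] -/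
theorem _root_.Literature.NumberTheory.EllipticCurves.Sprung2012.SharpFlatColemanKatoData.fine_lambdaInvariant_le_zeta_lambdaInvariant
    {col : Chroma} (C : SharpFlatColemanKatoData W p f ϖ κ γ ι ap g c col I)
    (hirr : W.HasIrreducibleModPGaloisRep p) {Lsharp Lflat G₁ : IwasawaAlgebra p}
    (hSP : IsSprungPair f p ap Lsharp Lflat) (hcol : chromaticL col Lsharp Lflat ≠ 0)
    (hG₁ : iwasawaToPowerSeries p G₁ =
      PowerSeries.C ((ϖ : ℚ) : ℚ_[p]) * iwasawaToPowerSeries p (chromaticL col Lsharp Lflat))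
    (hG0 : G₁ ≠ 0)
    (D : SharpFlatSelmerDualData W κ γ ι ap g c col) [Module.Finite (IwasawaAlgebra p) D.X]
    (hXt : Module.IsTorsion (IwasawaAlgebra p) D.X) (Y : W.FineSelmerDualData κ γ)
    (hKato : ∃ n : ℕ, (p : IwasawaAlgebra p) ^ n * chromaticL col Lsharp Lflat ∈ D.charIdeal) :
    lambdaInvariant p Y.X ≤ lambdaInvariant p (I.H ⧸ C.Z) := by
  haveI := C.moduleFinite_H W p hSP hcol
  haveI := C.moduleFinite_fine W p D Y
  exact lambdaInvariant_le_of_lengthAt_le (C.isTorsion_fine W p D hXt Y)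
    (C.isTorsion_quotient_zeta W p hirr hSP hcol hG₁ hG0)
    (fun 𝔮 h𝔮 hp𝔮 => C.fine_le_zeta_of_pow_mul_mem_charIdeal W p hirr hSP hcol hG₁ hG0 D hXt Y hKato 𝔮 h𝔮 hp𝔮)

/-- **β3 THE λ-BUDGET DOOR: «ONE integer closes every height-one prime off `(p)`».** Same data; if
`lambdaInvariant p (I.H ⧸ C.Z) ≤ lambdaInvariant p Y.X` (the FINE λ-BUDGET `λ(𝐇¹/Z) ≤ λ(X₀)`, displayed), then at EVERY height-one
`𝔭 ∌ p` — sporadic or cyclotomic — `ℓ_𝔭(I.H ⧸ C.Z) = ℓ_𝔭 Y.X`, in particular Kato's fine inequality `ℓ_𝔭(I.H ⧸ C.Z) ≤ ℓ_𝔭 Y.X`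
(the body of `stub_katoFineLowerSporadic` AND, through `eisenstein_iff_fine`, of S4b-cyc / S4b-T, for this pair).
[cite: Kato2004Asterisque, Conj. 12.10 (p. 224)] [cite: GreenbergVatsal2000, p. 4] [cite: Sprung2012, Prop. 7.19 (p. 1505)] -/
theorem _root_.Literature.NumberTheory.EllipticCurves.Sprung2012.SharpFlatColemanKatoData.zeta_eq_fine_offP_of_lambdaInvariant_le
    {col : Chroma} (C : SharpFlatColemanKatoData W p f ϖ κ γ ι ap g c col I)
    (hirr : W.HasIrreducibleModPGaloisRep p) {Lsharp Lflat G₁ : IwasawaAlgebra p}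
    (hSP : IsSprungPair f p ap Lsharp Lflat) (hcol : chromaticL col Lsharp Lflat ≠ 0)
    (hG₁ : iwasawaToPowerSeries p G₁ =
      PowerSeries.C ((ϖ : ℚ) : ℚ_[p]) * iwasawaToPowerSeries p (chromaticL col Lsharp Lflat))
    (hG0 : G₁ ≠ 0)
    (D : SharpFlatSelmerDualData W κ γ ι ap g c col) [Module.Finite (IwasawaAlgebra p) D.X]
    (hXt : Module.IsTorsion (IwasawaAlgebra p) D.X) (Y : W.FineSelmerDualData κ γ)
    (hKato : ∃ n : ℕ, (p : IwasawaAlgebra p) ^ n * chromaticL col Lsharp Lflat ∈ D.charIdeal)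
    (hbudget : lambdaInvariant p (I.H ⧸ C.Z) ≤ lambdaInvariant p Y.X)
    (𝔭 : PrimeSpectrum (IwasawaAlgebra p)) (h𝔭 : 𝔭.asIdeal.height = 1)
    (hp𝔭 : (p : IwasawaAlgebra p) ∉ 𝔭.asIdeal) :
    lengthAt (IwasawaAlgebra p) (I.H ⧸ C.Z) 𝔭 = lengthAt (IwasawaAlgebra p) Y.X 𝔭 := by
  haveI := C.moduleFinite_H W p hSP hcol
  haveI := C.moduleFinite_fine W p D Y
  exact (lengthAt_eq_of_lengthAt_le_of_lambdaInvariant_le (C.isTorsion_fine W p D hXt Y)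
    (C.isTorsion_quotient_zeta W p hirr hSP hcol hG₁ hG0)
    (fun 𝔮 h𝔮 hp𝔮 => C.fine_le_zeta_of_pow_mul_mem_charIdeal W p hirr hSP hcol hG₁ hG0 D hXt Y hKato 𝔮 h𝔮 hp𝔮)
    hbudget 𝔭 h𝔭 hp𝔭).symm

/-- **The door in the stub's inequality form**: under the fine λ-budget, `ℓ_𝔭(I.H ⧸ C.Z) ≤ ℓ_𝔭 Y.X` at every height-one `𝔭 ∌ p`.
[cite: Kato2004Asterisque, Conj. 12.10 (p. 224)] -/
theorem _root_.Literature.NumberTheory.EllipticCurves.Sprung2012.SharpFlatColemanKatoData.katoFineLower_offP_of_lambdaInvariant_le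
    {col : Chroma} (C : SharpFlatColemanKatoData W p f ϖ κ γ ι ap g c col I)
    (hirr : W.HasIrreducibleModPGaloisRep p) {Lsharp Lflat G₁ : IwasawaAlgebra p}
    (hSP : IsSprungPair f p ap Lsharp Lflat) (hcol : chromaticL col Lsharp Lflat ≠ 0)
    (hG₁ : iwasawaToPowerSeries p G₁ =
      PowerSeries.C ((ϖ : ℚ) : ℚ_[p]) * iwasawaToPowerSeries p (chromaticL col Lsharp Lflat))
    (hG0 : G₁ ≠ 0)
    (D : SharpFlatSelmerDualData W κ γ ι ap g c col) [Module.Finite (IwasawaAlgebra p) D.X]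
    (hXt : Module.IsTorsion (IwasawaAlgebra p) D.X) (Y : W.FineSelmerDualData κ γ)
    (hKato : ∃ n : ℕ, (p : IwasawaAlgebra p) ^ n * chromaticL col Lsharp Lflat ∈ D.charIdeal)
    (hbudget : lambdaInvariant p (I.H ⧸ C.Z) ≤ lambdaInvariant p Y.X)
    (𝔭 : PrimeSpectrum (IwasawaAlgebra p)) (h𝔭 : 𝔭.asIdeal.height = 1)
    (hp𝔭 : (p : IwasawaAlgebra p) ∉ 𝔭.asIdeal) :
    lengthAt (IwasawaAlgebra p) (I.H ⧸ C.Z) 𝔭 ≤ lengthAt (IwasawaAlgebra p) Y.X 𝔭 :=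
  (C.zeta_eq_fine_offP_of_lambdaInvariant_le W p hirr hSP hcol hG₁ hG0 D hXt Y hKato hbudget 𝔭 h𝔭 hp𝔭).le

end Package

/-! ### §3 The X8-pair form, binder shape `h714 → h716 → h3 → …` -/

/-- **THE λ-BUDGET DOOR ON AN X8 PAIR.** In the setting of Sprung 2012 Thm. 2.2 on an X8 pair (`p = 3`, `a₃ = ±3`), for every
newform, period ratio, Sprung pair, pinned `I` with JOINT ♯/♭ packages `Cs, Cf` (`Cs.Z = Cf.Z`) and every fine dual datum `Y`: if
`lambdaInvariant 3 (I.H ⧸ Cs.Z) ≤ lambdaInvariant 3 Y.X` (ONE integer), then `ℓ_𝔭(I.H ⧸ Cs.Z) ≤ ℓ_𝔭 Y.X` at EVERY height-one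
`𝔭 ∌ 3` — the body of `stub_katoFineLowerSporadic` at every sporadic prime and Kato's fine inequality at every cyclotomic prime of
the pair. Inputs: a non-vanishing colour (Rohrlich), its normalised `G` (`h3`), a real dual datum (f.g. torsion by `h714`), Thm. 7.16's
output (`h716`), then §2. CONDITIONAL on `h714`, `h716`, `h3` (displayed). [cite: Kato2004Asterisque, Conj. 12.10 (p. 224)]
[cite: Sprung2012, Prop. 6.14 (p. 1498), Thm. 7.14, Thm. 7.16 (p. 1504)] [cite: GreenbergVatsal2000, Rem. 3.4 and p. 4] -/
theorem ClassX8.katoFineLower_offThree_of_lambdaBudget (h714 : thm714_sharpFlatSelmerDual_finite_torsion)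
    (h716 : thm716_sharpFlatCharIdeal_divisibility) (h3 : realPeriodRat_eq_unit_mul_plusPeriod_three)
    (W : WeierstrassCurve ℚ) [W.IsElliptic] [W.IsGloballyMinimal] (p : ℕ) [Fact p.Prime]
    [ContinuousSMul ℤ_[p] (W.tateModule p)] [Module.Free ℤ_[p] (W.tateModule p)]
    [Module.Finite ℤ_[p] (W.tateModule p)]
    (hX : ClassX8 W p) (κ : ZpExtension ℚ p) (γ : Field.absoluteGaloisGroup ℚ)
    (hκ : κ.IsCyclotomic) (hγ : κ.IsTopGenerator γ) (hcv : IsCyclotomicVariable p γ)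
    (v : HeightOneSpectrum (𝓞 ℚ)) (hv : (p : 𝓞 ℚ) ∈ v.asIdeal)
    (g : Field.absoluteGaloisGroup (v.adicCompletion ℚ))
    (hg : κ.IsTopGenerator (resGalOfEmb (closureEmb (K := ℚ) (v.adicCompletion ℚ)) g))
    (cneg : localPoints W (v.adicCompletion ℚ)) (c : ℕ → localPoints W (v.adicCompletion ℚ))
    (hH : IsHondaSystem κ (closureEmb (K := ℚ) (v.adicCompletion ℚ)) W (W.frobeniusTrace p) g cneg c)
    (N : ℕ) (hN : NeZero N) (f : CuspForm (Gamma0 N) 2) (ϖ : ℚ) (Lsharp Lflat : IwasawaAlgebra p)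
    (hf : IsNewformOf W f) (hϖ : (ϖ : ℝ) * W.realPeriodRat = plusPeriod f)
    (hSP : IsSprungPair f p (W.frobeniusTrace p) Lsharp Lflat)
    (I : Kato2004.IwasawaH1Data W p κ γ)
    (Cs : SharpFlatColemanKatoData W p f ϖ κ γ (closureEmb (K := ℚ) (v.adicCompletion ℚ)) (W.frobeniusTrace p) g c
      Chroma.sharp I)
    (Cf : SharpFlatColemanKatoData W p f ϖ κ γ (closureEmb (K := ℚ) (v.adicCompletion ℚ)) (W.frobeniusTrace p) g c
      Chroma.flat I)
    (hZ : Cs.Z = Cf.Z) (Y : W.FineSelmerDualData κ γ)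
    (hbudget : lambdaInvariant p (I.H ⧸ Cs.Z) ≤ lambdaInvariant p Y.X)
    (𝔭 : PrimeSpectrum (IwasawaAlgebra p)) (h𝔭 : 𝔭.asIdeal.height = 1)
    (hp𝔭 : (p : IwasawaAlgebra p) ∉ 𝔭.asIdeal) :
    Module.lengthAt (IwasawaAlgebra p) (I.H ⧸ Cs.Z) 𝔭 ≤ Module.lengthAt (IwasawaAlgebra p) Y.X 𝔭 := by
  haveI : NeZero N := hN
  obtain ⟨hp3, ⟨hgood, hap⟩, -⟩ := id hX
  subst hp3
  have hp2 : (3 : ℕ) ≠ 2 := by decide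
  have hirr : W.HasIrreducibleModPGaloisRep 3 :=
    hasIrreducibleModPGaloisRep_of_dvd_frobeniusTrace W 3 hp2
      (W.not_dvd_minimalDiscriminantInt_of_hasGoodReductionAtPrime' 3 hgood) hap
  have hϖ0 : ϖ ≠ 0 := hf.periodRatio_ne_zero hϖ
  obtain ⟨hGall, -⟩ := stub_periodMu h3 W 3 hX N hN f ϖ Lsharp Lflat hf hϖ hSP
  have key : ∀ (c₀ : Chroma), chromaticL c₀ Lsharp Lflat ≠ 0 →
      ∀ (C : SharpFlatColemanKatoData W 3 f ϖ κ γ (closureEmb (K := ℚ) (v.adicCompletion ℚ))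
        (W.frobeniusTrace 3) g c c₀ I),
      lambdaInvariant 3 (I.H ⧸ C.Z) ≤ lambdaInvariant 3 Y.X →
      Module.lengthAt (IwasawaAlgebra 3) (I.H ⧸ C.Z) 𝔭 ≤ Module.lengthAt (IwasawaAlgebra 3) Y.X 𝔭 := by
    intro c₀ hc₀ C hb
    obtain ⟨G, hG⟩ := hGall c₀
    have hG0 : G ≠ 0 := by
      intro h0
      rw [h0, map_zero, eq_comm, mul_eq_zero] at hG
      rcases hG with hC | hL
      · have h1 : ((ϖ : ℚ) : ℚ_[3]) = 0 := by simpa using congrArg PowerSeries.constantCoeff hC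
        exact hϖ0 (by exact_mod_cast h1)
      · exact hc₀ (iwasawaToPowerSeries_injective 3 (by rw [hL, map_zero]))
    obtain ⟨D⟩ := nonempty_sharpFlatSelmerDualData_rat W κ γ v g c c₀
    obtain ⟨hfin, hXt⟩ := h714 W 3 hp2 hgood hap f hf κ γ hκ hγ hcv v hv g hg cneg c hH c₀ Lsharp Lflat hSP hc₀ D
    haveI := hfin
    have hKato := (h716 W 3 hp2 hgood hap f hf κ γ hκ hγ hcv v hv g hg cneg c hH c₀ Lsharp Lflat hSP hc₀ D hXt).1
    exact C.katoFineLower_offP_of_lambdaInvariant_le W 3 hirr hSP hc₀ hG hG0 D hXt Y hKato hb 𝔭 h𝔭 hp𝔭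
  rcases IsSprungPair.ne_zero_or_ne_zero hf hgood hSP with hs | hfl
  · exact key Chroma.sharp hs Cs hbudget
  · rw [hZ] at hbudget ⊢; exact key Chroma.flat hfl Cf hbudget

end Summit.BirchSwinnertonDyer.BirchSwinnertonDyer.Theorems.ChromaticCommonZeros

end

noncomputable section

open scoped Classical NumberField MatrixGroups ModularForm

open NumberField IsDedekindDomain CongruenceSubgroup WeierstrassCurve Field
  Literature.NumberTheory.EllipticCurves Literature.NumberTheory.EllipticCurves.ModularForms
  Literature.NumberTheory.EllipticCurves.ZpExtension Literature.NumberTheory.EllipticCurves.Sprung2017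
  Literature.NumberTheory.EllipticCurves.Sprung2012 Literature.NumberTheory.EllipticCurves.Rank1Residual
  Literature.NumberTheory.EllipticCurves.IwasawaAlgebra Literature.NumberTheory.EllipticCurves.Kato2004
  Literature.NumberTheory.EllipticCurves.Module
  Summit.BirchSwinnertonDyer.BirchSwinnertonDyer.Theorems
  Summit.BirchSwinnertonDyer.BirchSwinnertonDyer.Theorems.SmallImageSignedMuDefect
  Summit.BirchSwinnertonDyer.Rank1Residual.X1

/-! ### §4 (appended, w2 g7) The budget is an EXACT reformulation per pair: `λ(𝐇¹/Z) ≤ λ(X₀) ⟺ (k ≤ x at every 𝔭 ∌ p)` -/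

namespace Summit.BirchSwinnertonDyer.BirchSwinnertonDyer.Theorems.ChromaticCommonZeros

section Converse

variable (W : WeierstrassCurve ℚ) [W.IsElliptic] (p : ℕ) [Fact p.Prime]
  [ContinuousSMul ℤ_[p] (W.tateModule p)] [Module.Free ℤ_[p] (W.tateModule p)]
  [Module.Finite ℤ_[p] (W.tateModule p)]
  {N : ℕ} {f : CuspForm (Gamma0 N) 2} {ϖ : ℚ} {κ : ZpExtension ℚ p} {γ : absoluteGaloisGroup ℚ}
  {E : Type} [Field E] [Algebra ℚ E] {ι : AlgebraicClosure ℚ →ₐ[ℚ] AlgebraicClosure E} {ap : ℤ}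
  {g : absoluteGaloisGroup E} {c : ℕ → localPoints W E} {I : IwasawaH1Data W p κ γ}

/-- **The converse: Kato's fine inequality at every height-one `𝔭 ∌ p` GIVES the budget** `λ(I.H ⧸ C.Z) ≤ λ(Y.X)` (package `C` of
colour `•`, `L^• ≠ 0`, `E[p]` irreducible, `G₁ ≠ 0`, `D` f.g. torsion; `lambdaInvariant_le_of_lengthAt_le`) — so for one pair the fine
λ-budget is an EXACT reformulation of «K_spor ∧ KFL at the cyclotomic primes, off `(p)`». [cite: Kato2004Asterisque, Conj. 12.10 (p. 224)] -/
theorem _root_.Literature.NumberTheory.EllipticCurves.Sprung2012.SharpFlatColemanKatoData.zeta_lambdaInvariant_le_of_katoFineLower_offP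
    {col : Chroma} (C : SharpFlatColemanKatoData W p f ϖ κ γ ι ap g c col I)
    (hirr : W.HasIrreducibleModPGaloisRep p) {Lsharp Lflat G₁ : IwasawaAlgebra p}
    (hSP : IsSprungPair f p ap Lsharp Lflat) (hcol : chromaticL col Lsharp Lflat ≠ 0)
    (hG₁ : iwasawaToPowerSeries p G₁ =
      PowerSeries.C ((ϖ : ℚ) : ℚ_[p]) * iwasawaToPowerSeries p (chromaticL col Lsharp Lflat))
    (hG0 : G₁ ≠ 0)
    (D : SharpFlatSelmerDualData W κ γ ι ap g c col) [Module.Finite (IwasawaAlgebra p) D.X]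
    (hXt : Module.IsTorsion (IwasawaAlgebra p) D.X) (Y : W.FineSelmerDualData κ γ)
    (hKFL : ∀ 𝔭 : PrimeSpectrum (IwasawaAlgebra p), 𝔭.asIdeal.height = 1 → (p : IwasawaAlgebra p) ∉ 𝔭.asIdeal →
      lengthAt (IwasawaAlgebra p) (I.H ⧸ C.Z) 𝔭 ≤ lengthAt (IwasawaAlgebra p) Y.X 𝔭) :
    lambdaInvariant p (I.H ⧸ C.Z) ≤ lambdaInvariant p Y.X := by
  haveI := C.moduleFinite_H W p hSP hcol
  haveI := C.moduleFinite_fine W p D Y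
  exact lambdaInvariant_le_of_lengthAt_le (C.isTorsion_quotient_zeta W p hirr hSP hcol hG₁ hG0)
    (C.isTorsion_fine W p D hXt Y) hKFL

/-- **`FineLambdaBudget ⟺ KFL off (p)`, per package** (given Thm. 7.16's output `hKato` for the reverse direction):
`lambdaInvariant p (I.H ⧸ C.Z) ≤ lambdaInvariant p Y.X ↔ ∀ height-one 𝔭 ∌ p, ℓ_𝔭(I.H ⧸ C.Z) ≤ ℓ_𝔭 Y.X`.
[cite: Kato2004Asterisque, Conj. 12.10 (p. 224)] [cite: GreenbergVatsal2000, p. 4] -/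
theorem _root_.Literature.NumberTheory.EllipticCurves.Sprung2012.SharpFlatColemanKatoData.zeta_lambdaInvariant_le_iff_katoFineLower_offP
    {col : Chroma} (C : SharpFlatColemanKatoData W p f ϖ κ γ ι ap g c col I)
    (hirr : W.HasIrreducibleModPGaloisRep p) {Lsharp Lflat G₁ : IwasawaAlgebra p}
    (hSP : IsSprungPair f p ap Lsharp Lflat) (hcol : chromaticL col Lsharp Lflat ≠ 0)
    (hG₁ : iwasawaToPowerSeries p G₁ =
      PowerSeries.C ((ϖ : ℚ) : ℚ_[p]) * iwasawaToPowerSeries p (chromaticL col Lsharp Lflat))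
    (hG0 : G₁ ≠ 0)
    (D : SharpFlatSelmerDualData W κ γ ι ap g c col) [Module.Finite (IwasawaAlgebra p) D.X]
    (hXt : Module.IsTorsion (IwasawaAlgebra p) D.X) (Y : W.FineSelmerDualData κ γ)
    (hKato : ∃ n : ℕ, (p : IwasawaAlgebra p) ^ n * chromaticL col Lsharp Lflat ∈ D.charIdeal) :
    lambdaInvariant p (I.H ⧸ C.Z) ≤ lambdaInvariant p Y.X ↔
      ∀ 𝔭 : PrimeSpectrum (IwasawaAlgebra p), 𝔭.asIdeal.height = 1 → (p : IwasawaAlgebra p) ∉ 𝔭.asIdeal →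
        lengthAt (IwasawaAlgebra p) (I.H ⧸ C.Z) 𝔭 ≤ lengthAt (IwasawaAlgebra p) Y.X 𝔭 :=
  ⟨fun hb 𝔭 h𝔭 hp𝔭 => C.katoFineLower_offP_of_lambdaInvariant_le W p hirr hSP hcol hG₁ hG0 D hXt Y hKato hb 𝔭 h𝔭 hp𝔭,
    C.zeta_lambdaInvariant_le_of_katoFineLower_offP W p hirr hSP hcol hG₁ hG0 D hXt Y⟩
end Converse

end Summit.BirchSwinnertonDyer.BirchSwinnertonDyer.Theorems.ChromaticCommonZeros

end
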